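import Summits.ABC.ABC.Theorems.TowerFourSubLiouville.Negative.HallLangTransferTridentPell

/-!
# `TowerFourSubLiouville` (stmt-ABC-1649): the corner `(2, 0)` — value EXACTLY `1` at quadratic coefficient height

Negative-side module of the standing disprover (cycle 11, refuter-cdisprove-stmt-ABC-1649-g11-0, 2026-08-17), companion of
`Negative.TwoExponentDiagram` (p126869: corners `(2,1)`, `(1,3/2)`, `(0,2)`, `(3,0)`), `Negative.HallLangTransferTridentPell`
(p133548: the torus corner `(8/3, 0)`) and `Negative.TwoExponentSandwich` (p137739: the `ABC` half-plane `(9/4)θ + φ < 2`).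

**The family.**  Bezout for the coprime pair `u⁴`, `(u² − 1)²` has cofactors of degree TWO (parity):

  `(2u² + 1)(u² − 1)² − (2u² − 3)u⁴ = 1`,

and along the Pell sequence `u² − 2t² = 1` (`(3,2), (17,12), (99,70), …`, step `(u,t) ↦ (3u + 4t, 2u + 3t)`) the square
`(u² − 1)² = 4t⁴` is four times a fourth power.  With `Z = t`, `Y = u`, `w = 4(2u² + 1) = 16t² + 12`, `v = 2u² − 3 = 4t² − 1`:

  **`(16Z² + 12)·Z⁴ − (4Z² − 1)·Y⁴ = 1`,   `Y² = 2Z² + 1`**      (`76·2⁴ − 15·3⁴ = 1216 − 1215`, `2316·12⁴ − 575·17⁴ = 1`, …)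

(`pellBezout_identity`, `exists_pellBezout`): a coprime binomial quartic form of height `max(v,w) = 16Z² + 12 ≤ 28 Z²` takes the
value EXACTLY `1` at `(Y, Z)` with `Z` unbounded.  In the two-exponent diagram (`UBQ₂(θ, φ)`: `max(v,w) ≤ Z^θ ⟹ |wZ⁴ − vY⁴| > Z^φ`)
this is the corner **`(2, 0)`** (`not_ubq₂_corner_two_zero`: FALSE for every `θ > 2`, `φ ≥ 0`), which SUPERSEDES three landed
corners at once — `(3, 0)` (`bezoutFamily₃`, the `z = 1` ℙ¹ Bezout identity), `(8/3, 0)` (trident–Pell) and `(2, 1)` (`padeFamily₁`) —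
so the proved FALSE region is now the union of three lobes `{θ > 2, φ ≥ 0} ∪ {θ > 1, φ > 3/2} ∪ {θ > 0, φ > 2}` (`ubq₂_false_of_corner₆`,
stated with the old disjuncts still accepted so that existing callers need not change).

**Why it matters (calibration, not a kill — the diagonal value is `2 > 3/2`).**
* It is a TORUS identity of shape `(d_Z, d_Y, d_v, d_w, d_a) = (1, 1, 2, 2, 0)` — both coefficients of width `2`, value constant —
  a shape outside the cycle-4 (all widths `1`) and cycle-10 (`w` constant) censuses; it is tight for the torus Mason–Stothers
  inequality `(3/4)θ_v + (1/4)θ_w + φ ≥ 2` of `Negative.TorusEnemyFloor` with `θ_v = θ_w`, i.e. **it lies ON the random-model boundary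
  `θ + φ = 2`** — after the Dirichlet corner `(0, 2)` (a limit `θ → 0⁺`) the second proved point of that line and the first one at
  positive coefficient height / below `φ = 2`.  So the conjectural TRUE region `{θ + φ < 2}` cannot be enlarged at `(2, 0)`, and at
  `φ = 0` the truth is bracketed `8/9 ≤ θ* ≤ 2` (`ABC` floor of p137739 vs. this corner).
* The Thue rung `UniformMovingThue4` of the strategist's ladder (`StrategistSketch.lean`; `ABC`-true with budget `(1+ε)/3`, p137739) has
  budget at most `2` at every `ε ≤ 1` (`movingThue4_budget_le_two`; was `8/3`).
* The strategist's unit slice Dc1 / S⁺7 (`a = wZ⁴ − vY⁴ ∣ 4`: "binomial units", Cohn–Ljunggren index theorems, residue = shape of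
  the fundamental unit of `ℤ[√(vw)]`): the ON-piece `UBQOn unitSlice η` is FALSE for every `η > 2` (`not_ubqOn_unitSlice_of_two_lt`,
  matrix verbatim) — the family consists of value-`1` enemies, i.e. of norm-one units `(2wZ⁴ − 1) + 2Y²Z²·√(vw)` of the orders
  `ℤ[√((4Z²−1)(16Z²+12))]`, given by the POLYNOMIAL Pell identity `(32Z⁶ + 24Z⁴ − 1)² − (4Z² − 1)(16Z² + 12)(4Z⁴ + 2Z²)² = 1`
  (`pellBezout_unit_identity`): units of size `≍ D^{3/2}` in discriminant `D ≍ Z⁴`, doubly-square second coordinate as soon as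
  `2Z² + 1 = Y²`.  Any "doubly-quartic unit ⟹ contradiction" argument on the unit slice must therefore use `vw > Z^{4+δ}`-type
  information beyond `η ≤ 2`.
Found by the seat's census of the `ι`-symmetric torus shape `(1,1,2,2,0)` (`u`-line Belyi maps `w(u)(u² − n)²/(v(u)(u + y₀)⁴)`,
passport `[2,2,1,1] [4,1,1] [6]`): the real dessins are ALL rational up to scaling — this one (`n = 1`, `y₀ = 0`), its twin on the
negative Pell conic `u² + 1 = 2t²` (`(2u² + 3)u⁴ − (2u² − 1)(u² + 1)² = 1`, i.e. `(4t² + 1)u⁴ − (16t² − 12)t⁴ = 1`: `101·7⁴ − 388·5⁴ = 1`,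
`3365·41⁴ − 13444·29⁴ = 1`; same corner), and a `y₀ ≠ 0` dessin rational on norm-`(−15)`-type conics (not needed).
-/

-- `Summit.ABC.ABC` is the mandated summit-side namespace (CONVENTIONS §2); the duplicate is deliberate.
set_option linter.dupNamespace false

namespace Summit.ABC.ABC.Theorems.TowerFourSubLiouville.Negative

/-! ## The Pell–Bezout family -/

/-- **Bezout for `u⁴` and `(u² − 1)²`, boosted by Pell**: `u² = 2t² + 1 ⟹ (16t² + 12)·t⁴ = (4t² − 1)·u⁴ + 1` (`t ≥ 1`). -/
theorem pellBezout_identity {u t : ℕ} (h : u ^ 2 = 2 * t ^ 2 + 1) (ht : 1 ≤ t) :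
    (16 * t ^ 2 + 12) * t ^ 4 = (4 * t ^ 2 - 1) * u ^ 4 + 1 := by
  have h1 : 1 ≤ 4 * t ^ 2 := by nlinarith
  zify [h1]
  have hz : ((u : ℤ)) ^ 2 = 2 * (t : ℤ) ^ 2 + 1 := by exact_mod_cast h
  have hu4 : ((u : ℤ)) ^ 4 = (2 * (t : ℤ) ^ 2 + 1) ^ 2 := by rw [← hz]; ring
  rw [hu4]; ring

/-- The polynomial identity behind it (over `ℤ`, no Pell needed): `(2u² + 1)(u² − 1)² − (2u² − 3)u⁴ = 1`. -/
theorem bezout_sq_identity (u : ℤ) : (2 * u ^ 2 + 1) * (u ^ 2 - 1) ^ 2 - (2 * u ^ 2 - 3) * u ^ 4 = 1 := by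
  ring

/-- One step of the Pell recursion for `u² − 2t² = 1`. -/
theorem pell2_step {u t : ℕ} (h : u ^ 2 = 2 * t ^ 2 + 1) :
    (3 * u + 4 * t) ^ 2 = 2 * (2 * u + 3 * t) ^ 2 + 1 := by
  nlinarith [h]

/-- Pell solutions of `u² = 2t² + 1` with `t` beyond any bound (start `(3, 2)`). -/
theorem pell2_exists_ge (N : ℕ) : ∃ u t : ℕ, u ^ 2 = 2 * t ^ 2 + 1 ∧ N ≤ t ∧ 1 ≤ t := by
  induction N with
  | zero => exact ⟨3, 2, by norm_num, Nat.zero_le _, by norm_num⟩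
  | succ n ih =>
    obtain ⟨u, t, h, hnt, ht⟩ := ih
    exact ⟨3 * u + 4 * t, 2 * u + 3 * t, pell2_step h, by omega, by omega⟩

/-- **The family packaged**: beyond every height a coprime quadruple with `wZ⁴ = vY⁴ + 1`, `v ≤ w = 16Z² + 12 ≤ 28Z²`
(coprimality `gcd(vY, wZ) = 1` is forced by the value `1`). -/
theorem exists_pellBezout (N : ℕ) : ∃ v w Y Z : ℕ, N ≤ Z ∧ 0 < v ∧ 0 < w ∧ 0 < Y ∧ 1 ≤ Z ∧
    Nat.Coprime (v * Y) (w * Z) ∧ w * Z ^ 4 = v * Y ^ 4 + 1 ∧ v ≤ w ∧ w ≤ 28 * Z ^ 2 ∧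
    w = 16 * Z ^ 2 + 12 ∧ v = 4 * Z ^ 2 - 1 ∧ Y ^ 2 = 2 * Z ^ 2 + 1 := by
  obtain ⟨u, t, h, hNt, ht⟩ := pell2_exists_ge N
  have hid := pellBezout_identity h ht
  have hu : 0 < u := by
    rcases Nat.eq_zero_or_pos u with h0 | h0
    · subst h0; simp at h
    · exact h0
  have hv : 0 < 4 * t ^ 2 - 1 := by
    have : 4 ≤ 4 * t ^ 2 := by nlinarith
    omega
  refine ⟨4 * t ^ 2 - 1, 16 * t ^ 2 + 12, u, t, hNt, hv, by positivity, hu, ht, ?_, hid, by omega, by nlinarith,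
    rfl, rfl, h⟩
  exact coprime_of_int_combination (a := -((u : ℤ) ^ 3)) (b := (t : ℤ) ^ 3) (r := 1)
    (by
      have hid' : (((16 * t ^ 2 + 12) * t ^ 4 : ℕ) : ℤ) = (((4 * t ^ 2 - 1) * u ^ 4 + 1 : ℕ) : ℤ) := by
        exact_mod_cast hid
      push_cast at hid' ⊢
      linear_combination hid')
    (Nat.coprime_one_left _)

/-- The two smallest members: `76·2⁴ − 15·3⁴ = 1` and `2316·12⁴ − 575·17⁴ = 1`. -/
example : (76 : ℕ) * 2 ^ 4 = 15 * 3 ^ 4 + 1 ∧ (2316 : ℕ) * 12 ^ 4 = 575 * 17 ^ 4 + 1 := by norm_num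

/-- **The unit behind the family** (the strategist's S⁺7 reading of value-`1` enemies): a POLYNOMIAL solution of the Pell equation
`X² − vw·W² = 1` for `(v, w) = (4Z² − 1, 16Z² + 12)`, with `W = 2(2Z² + 1)Z² = 2Y²Z²` doubly square whenever `2Z² + 1 = Y²`. -/
theorem pellBezout_unit_identity (Z : ℤ) :
    (32 * Z ^ 6 + 24 * Z ^ 4 - 1) ^ 2 - (4 * Z ^ 2 - 1) * (16 * Z ^ 2 + 12) * (4 * Z ^ 4 + 2 * Z ^ 2) ^ 2 = 1 := by
  ring

/-! ## Corner `(2, 0)` and the new shape of the FALSE region -/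

/-- **Corner `(2, 0)`: `UBQ₂(θ, φ)` fails for `θ > 2` and EVERY `φ ≥ 0`** — the value of a coprime binomial quartic form can be
exactly `1` at QUADRATIC coefficient height (supersedes `(3,0)`, `(8/3,0)` and `(2,1)`). -/
theorem not_ubq₂_corner_two_zero (θ φ : ℝ) (hθ : 2 < θ) (hφ : 0 ≤ φ) :
    ¬ ∃ Z₀ : ℕ, ∀ v w Y Z : ℕ, Z₀ ≤ Z → 0 < v → 0 < w → 0 < Y → Nat.Coprime (v * Y) (w * Z) →
      ((max v w : ℕ) : ℝ) ≤ (Z : ℝ) ^ θ → w * Z ^ 4 ≠ v * Y ^ 4 →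
      (Z : ℝ) ^ φ < |((w * Z ^ 4 : ℕ) : ℝ) - ((v * Y ^ 4 : ℕ) : ℝ)| := by
  rintro ⟨Z₀, h⟩
  obtain ⟨N₁, hN₁⟩ := eventually_const_mul_rpow_le 28 2 θ hθ
  obtain ⟨v, w, Y, Z, hNZ, hv, hw, hY, hZ1, hcop, hid, hvw, hw28, -, -, -⟩ := exists_pellBezout (max Z₀ N₁)
  have hZ₀ : Z₀ ≤ Z := le_trans (le_max_left _ _) hNZ
  have h1 := hN₁ Z (le_trans (le_max_right _ _) hNZ)
  rw [show ((Z : ℝ) ^ (2 : ℝ)) = (Z : ℝ) ^ (2 : ℕ) from by rw [← Real.rpow_natCast]; norm_num] at h1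
  have hmax : ((max v w : ℕ) : ℝ) ≤ (Z : ℝ) ^ θ := by
    rw [max_eq_right hvw]
    have : (w : ℝ) ≤ 28 * (Z : ℝ) ^ 2 := by exact_mod_cast hw28
    linarith
  have hne : w * Z ^ 4 ≠ v * Y ^ 4 := by rw [hid]; omega
  have key := h v w Y Z hZ₀ hv hw hY hcop hmax hne
  have habs : |((w * Z ^ 4 : ℕ) : ℝ) - ((v * Y ^ 4 : ℕ) : ℝ)| = 1 := by
    rw [hid]; push_cast
    rw [show (((v : ℝ) * (Y : ℝ) ^ 4 + 1) - (v : ℝ) * (Y : ℝ) ^ 4) = 1 by ring]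
    norm_num
  rw [habs] at key
  have hZR : (1 : ℝ) ≤ Z := by exact_mod_cast hZ1
  have : (1 : ℝ) ≤ (Z : ℝ) ^ φ := Real.one_le_rpow hZR hφ
  linarith

/-- **The proved FALSE region after cycle 11**: three lobes `{θ > 2, φ ≥ 0} ∪ {θ > 1, φ > 3/2} ∪ {θ > 0, φ > 2}` suffice; the
disjuncts of `ubq₂_false_of_corner₅` (`(8/3,0)`, `(2,1)`) are still accepted for the convenience of existing callers. -/
theorem ubq₂_false_of_corner₆ {θ φ : ℝ}
    (hc : (2 < θ ∧ 0 ≤ φ) ∨ (8 / 3 < θ ∧ 0 ≤ φ) ∨ (2 < θ ∧ 1 < φ) ∨ (1 < θ ∧ 3 / 2 < φ) ∨ (0 < θ ∧ 2 < φ)) :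
    ¬ ∃ Z₀ : ℕ, ∀ v w Y Z : ℕ, Z₀ ≤ Z → 0 < v → 0 < w → 0 < Y → Nat.Coprime (v * Y) (w * Z) →
      ((max v w : ℕ) : ℝ) ≤ (Z : ℝ) ^ θ → w * Z ^ 4 ≠ v * Y ^ 4 →
      (Z : ℝ) ^ φ < |((w * Z ^ 4 : ℕ) : ℝ) - ((v * Y ^ 4 : ℕ) : ℝ)| := by
  rcases hc with ⟨hθ, hφ⟩ | hc
  · exact not_ubq₂_corner_two_zero θ φ hθ hφ
  · exact ubq₂_false_of_corner₅ hc

/-- On the line `φ = 0` the dial is now bracketed: FALSE for `θ > 2` (this file), `ABC`-TRUE for `θ < 8/9` (p137739). -/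
example (θ : ℝ) (hθ : 2 < θ) :
    ¬ ∃ Z₀ : ℕ, ∀ v w Y Z : ℕ, Z₀ ≤ Z → 0 < v → 0 < w → 0 < Y → Nat.Coprime (v * Y) (w * Z) →
      ((max v w : ℕ) : ℝ) ≤ (Z : ℝ) ^ θ → w * Z ^ 4 ≠ v * Y ^ 4 →
      (Z : ℝ) ^ (0:ℝ) < |((w * Z ^ 4 : ℕ) : ℝ) - ((v * Y ^ 4 : ℕ) : ℝ)| :=
  not_ubq₂_corner_two_zero θ 0 hθ le_rfl

/-! ## Consequences for the strategist's ladder and unit slice -/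

/-- Thue rung of the moving-target ladder (`StrategistSketch.UniformMovingThue4`, matrix verbatim): at any `ε ≤ 1` no budget
`η > 2` is possible (was `8/3`, `Negative.TwoExponentSandwich.movingThue4_budget_le`). -/
theorem movingThue4_budget_le_two {ε η : ℝ} (hε : ε ≤ 1) (hη : 2 < η) :
    ¬ ∃ Z₀ : ℕ, ∀ v w Y Z : ℕ, Z₀ ≤ Z → 0 < v → 0 < w → 0 < Y → Nat.Coprime (v * Y) (w * Z) →
      ((max v w : ℕ) : ℝ) ≤ (Z : ℝ) ^ η → w * Z ^ 4 ≠ v * Y ^ 4 →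
      (Z : ℝ) ^ (1 - ε) < |((w * Z ^ 4 : ℕ) : ℝ) - ((v * Y ^ 4 : ℕ) : ℝ)| :=
  not_ubq₂_corner_two_zero η (1 - ε) hη (by linarith)

/-- **The unit slice is not easier than height `2`**: the ON-piece `UBQOn unitSlice η` of the strategist's split Dc1
(`StrategistSketch.UBQOn` / `unitSlice`, matrices verbatim: the core restricted to `wZ⁴ − vY⁴ ∣ 4`) is FALSE for every `η > 2` —
the Pell–Bezout enemies have value `1 ∣ 4`. -/
theorem not_ubqOn_unitSlice_of_two_lt (η : ℝ) (hη : 2 < η) :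
    ¬ ∃ Z₀ : ℕ, ∀ v w Y Z : ℕ, Z₀ ≤ Z → ((w * Z ^ 4 : ℤ) - (v * Y ^ 4 : ℤ)) ∣ 4 → 0 < v → 0 < w → 0 < Y →
      Nat.Coprime (v * Y) (w * Z) → ((max v w : ℕ) : ℝ) ≤ (Z : ℝ) ^ η → w * Z ^ 4 ≠ v * Y ^ 4 →
      (Z : ℝ) ^ η < |((w * Z ^ 4 : ℕ) : ℝ) - ((v * Y ^ 4 : ℕ) : ℝ)| := by
  rintro ⟨Z₀, h⟩
  obtain ⟨N₁, hN₁⟩ := eventually_const_mul_rpow_le 28 2 η hη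
  obtain ⟨v, w, Y, Z, hNZ, hv, hw, hY, hZ1, hcop, hid, hvw, hw28, -, -, -⟩ := exists_pellBezout (max Z₀ N₁)
  have hZ₀ : Z₀ ≤ Z := le_trans (le_max_left _ _) hNZ
  have h1 := hN₁ Z (le_trans (le_max_right _ _) hNZ)
  rw [show ((Z : ℝ) ^ (2 : ℝ)) = (Z : ℝ) ^ (2 : ℕ) from by rw [← Real.rpow_natCast]; norm_num] at h1
  have hmax : ((max v w : ℕ) : ℝ) ≤ (Z : ℝ) ^ η := by
    rw [max_eq_right hvw]
    have : (w : ℝ) ≤ 28 * (Z : ℝ) ^ 2 := by exact_mod_cast hw28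
    linarith
  have hne : w * Z ^ 4 ≠ v * Y ^ 4 := by rw [hid]; omega
  have hunit : ((w * Z ^ 4 : ℤ) - (v * Y ^ 4 : ℤ)) ∣ 4 := by
    have hid' : ((w * Z ^ 4 : ℕ) : ℤ) = ((v * Y ^ 4 + 1 : ℕ) : ℤ) := by exact_mod_cast hid
    push_cast at hid'
    rw [show ((w * Z ^ 4 : ℤ) - (v * Y ^ 4 : ℤ)) = 1 by rw [hid']; ring]
    norm_num
  have key := h v w Y Z hZ₀ hunit hv hw hY hcop hmax hne
  have habs : |((w * Z ^ 4 : ℕ) : ℝ) - ((v * Y ^ 4 : ℕ) : ℝ)| = 1 := by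
    rw [hid]; push_cast
    rw [show (((v : ℝ) * (Y : ℝ) ^ 4 + 1) - (v : ℝ) * (Y : ℝ) ^ 4) = 1 by ring]
    norm_num
  rw [habs] at key
  have hZR : (1 : ℝ) ≤ Z := by exact_mod_cast hZ1
  have : (1 : ℝ) ≤ (Z : ℝ) ^ η := Real.one_le_rpow hZR (by linarith)
  linarith

end Summit.ABC.ABC.Theorems.TowerFourSubLiouville.Negative
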